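import Literature.Barriers.RiemannHypothesis.EpsteinZetaRealZerosDHEven
import Literature.Barriers.RiemannHypothesis.DavenportHeilbronnSeries
import Mathlib.Analysis.Fourier.FiniteAbelian.PontryaginDuality
import HarnessLib

/-!
# Davenport–Heilbronn for Epstein zeta functions, VI: Theorem 3 of Davenport–Heilbronn I at the
# level of the field — even class number

Sibling of `Literature/Barriers/RiemannHypothesis/EpsteinZetaRealZeros.lean` (named fact
`DavenportHeilbronn1936b_epstein`). Everything in this file is PROVED; no definitions, no named facts.

Davenport–Heilbronn I, §4: "Let `Q` be a positive definite quadratic form with a fundamental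
discriminant `d` for which `h(d)` is even […] Since the order of the class-group is even, there
exists a real non-principal character `χ₁`. For any prime `p`, we define `a(p) = i` if there is a
prime ideal factor `𝔭` of `p` for which `χ₁(𝔭) = −1`, `a(p) = 1` otherwise. For composite `n`, we
define `a(n)` as in § 2 [`a(n) = a(p₁)^{ν₁} ⋯ a(p_r)^{ν_r}`]. […] THEOREM 3: `ζ(s, Q)` has an infinity
of zeros for `σ > 1`."

Here the two remaining existence statements of that paragraph are supplied — the real
non-principal character (`exists_real_addChar_of_even_card`: the character group of `Cl(K)` has
the same, even, order, so Cauchy's theorem gives a character of order `2`) and the completely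
multiplicative `a` with the printed prime values (the tree's `complMul`,
`DavenportHeilbronnSeries.lean`) — and combined with
`davenportHeilbronn_conclusion_of_real_addChar` (`EpsteinZetaRealZerosDHEven.lean`):
`davenportHeilbronn_conclusion_of_even_card` is Theorem 3 (with Titchmarsh's `≫ T` count of
§10.25) for the form `(A, t − 2k, C)` of a lattice ideal `(A, ω − k)` of an imaginary quadratic
field `K` (`[K:ℚ] = 2`, `d_K < −4`) with `h_K` even.

## References

* [DavenportHeilbronn1936a] H. Davenport, H. Heilbronn, *On the zeros of certain Dirichlet
  series I*, J. London Math. Soc. 11 (1936), 181–185, §4 and Theorem 3.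
* [Titchmarsh1986] E. C. Titchmarsh, *The Theory of the Riemann Zeta-Function*, 2nd ed., §10.25.
-/

noncomputable section

open Filter Topology Complex NumberField IsDedekindDomain Module Set
open Literature.NumberTheory.LFunctions Literature.NumberTheory.LFunctions.AbelianDensity
open Literature.NumberTheory.QuadraticFields.Quadratic
open scoped nonZeroDivisors Classical

namespace Literature.Barriers.RiemannHypothesis

namespace DHEpstein

variable {K : Type*} [Field K] [NumberField K]

/-- **A class group of even order has a real non-principal character** (D–H I §4: "Since the
order of the class-group is even, there exists a real non-principal character `χ₁`"): the
character group of the finite abelian group `Cl(K)` has the same order (Mathlib's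
`AddChar.card_eq`), so by Cauchy's theorem it has an element `χ₁` of order `2`, and then
`χ₁(g)² = (χ₁ + χ₁)(g) = 1`. [cite: DavenportHeilbronn1936a, §4] -/
theorem exists_real_addChar_of_even_card (heven : Even (Nat.card (ClassGroup (𝓞 K)))) :
    ∃ χ₁ : AddChar (Additive (ClassGroup (𝓞 K))) ℂ, χ₁ ≠ 0 ∧
      ∀ g, toMulHom χ₁ g = 1 ∨ toMulHom χ₁ g = -1 := by
  have hcard : 2 ∣ Fintype.card (AddChar (Additive (ClassGroup (𝓞 K))) ℂ) := by
    rw [AddChar.card_eq, Fintype.card_congr Additive.ofMul.symm, Fintype.card_eq_nat_card]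
    exact even_iff_two_dvd.mp heven
  haveI : Fact (Nat.Prime 2) := ⟨Nat.prime_two⟩
  obtain ⟨χ₁, hχ₁⟩ := exists_prime_addOrderOf_dvd_card 2 hcard
  refine ⟨χ₁, ?_, fun g ↦ ?_⟩
  · intro h0
    rw [h0, addOrderOf_zero] at hχ₁
    exact absurd hχ₁ (by norm_num)
  · have h2 : χ₁ + χ₁ = 0 := by
      have := addOrderOf_nsmul_eq_zero χ₁
      rwa [hχ₁, two_nsmul] at this
    have hsq : toMulHom χ₁ g * toMulHom χ₁ g = 1 := by
      rw [toMulHom_apply, ← AddChar.add_apply, h2, AddChar.zero_apply]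
    exact mul_self_eq_one_iff.mp hsq

/-- **Davenport–Heilbronn I, Theorem 3, with Titchmarsh's `≫ T` count — the form of a lattice
ideal of an imaginary quadratic field with even class number.** Let `K` be an imaginary quadratic
field (`[K:ℚ] = 2`) with integral basis `(1, ω)`, `ω² = m + tω`, `t² + 4m < −4`, let `A > 0`,
`AC = k² − tk − m` (so `(A, ω − k)` is the lattice ideal of the form `Q = (A, t − 2k, C)` of
discriminant `d_K`), and let `h_K` be even. Then `ζ(s, Q)` has infinitely many zeros in `σ > 1`,
and at least `C'·T` of them with `0 < ℑs ≤ T` for all large `T`. Proof: a real non-principal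
character `χ₁` (`exists_real_addChar_of_even_card`), the genus twist
`a = complMul (p ↦ i or 1)` with the printed prime values, and
`davenportHeilbronn_conclusion_of_real_addChar`. [cite: DavenportHeilbronn1936a, §4 Theorem 3]
[cite: Titchmarsh1986, §10.25] -/
theorem davenportHeilbronn_conclusion_of_even_card (h2 : finrank ℚ K = 2)
    (b : Basis (Fin 2) ℤ (𝓞 K)) (hb : b 0 = 1)
    {t m : ℤ} (hω : b 1 * b 1 = (m : 𝓞 K) + (t : 𝓞 K) * b 1) (hD : t ^ 2 + 4 * m < -4)
    {A k C : ℤ} (hA : 0 < A) (hn : A * C = k ^ 2 - t * k - m)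
    (heven : Even (Nat.card (ClassGroup (𝓞 K)))) :
    {s : ℂ | 1 < s.re ∧ epsteinZeta (A : ℝ) ((t - 2 * k : ℤ) : ℝ) (C : ℝ) s = 0}.Infinite ∧
      ∃ C' : ℝ, 0 < C' ∧ ∀ᶠ T : ℝ in atTop,
        C' * T ≤ ({s : ℂ | 1 < s.re ∧ 0 < s.im ∧ s.im ≤ T ∧
          epsteinZeta (A : ℝ) ((t - 2 * k : ℤ) : ℝ) (C : ℝ) s = 0}.ncard : ℝ) := by
  obtain ⟨χ₁, hχ₁, hreal⟩ := exists_real_addChar_of_even_card (K := K) heven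
  -- the genus twist with the printed prime values
  set g : ℕ → ℂ := fun p ↦ if (∃ v : HeightOneSpectrum (𝓞 K),
      Ideal.absNorm v.asIdeal = p ∧ toMulHom χ₁ (primeClass v) = -1) then I else 1 with hg
  set a : ℕ →* ℂ := (complMul g).toMonoidHom with ha
  have ha' : ∀ p : ℕ, p.Prime → a p = if (∃ v : HeightOneSpectrum (𝓞 K),
      Ideal.absNorm v.asIdeal = p ∧ toMulHom χ₁ (primeClass v) = -1) then I else 1 := by
    intro p hp
    rw [ha]
    show complMul g p = _
    rw [complMul_prime g hp]
  exact davenportHeilbronn_conclusion_of_real_addChar h2 b hb hω hD hA hn hχ₁ hreal ha'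

end DHEpstein

end Literature.Barriers.RiemannHypothesis
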